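import Summits.BirchSwinnertonDyer.BirchSwinnertonDyer.Theorems.PrintCFramBottomClassIndexLawFiveLeHerbrandKummerReflectionCount
import Literature.NumberTheory.NumberFields.UnitsEvenEigenunitsCount
import HarnessLib

/-!
# Route `PrintCFram`, crux C2 `BottomClassIndexLawFiveLe` (stmt-BirchSwinnertonDyer-20372), line
# `eisenstein-resource-bdp-line` (registry v19): **THE KUMMER REFLECTION COUNT FOR AN EVEN RADICAL CHARACTER** —
# `#Gal(M/K) ≤ p · #{(a·m)-eigenclasses in Cl_K[p]} ≤ p · #e_θ(ℤ_p ⊗ Cl_K)` for a `χ̄`-normalised abelian `M/K` of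
# exponent `p` unramified outside `p` whose radical character `ω̄χ̄⁻¹` is EVEN (the CASE R twin of w7 g3's p673425)
# (cell `bsd-print-cfram`, width seat `bsd-line-cfram-p1-w7` g4; helper `--supports` 20372; 0 defs, 0 facts, 0 sorry)

HONEST FRAMING. Nothing about BSD is proved here, no stub is closed. This is the EVEN-radical companion of
`HerbrandKummer.natCard_gal_le_natCard_eigenclasses_of_normalised_kummer` (p673425): there the radical character
`ψ̄ = ω̄χ̄⁻¹` was ODD and the map `χ ↦ [𝔟_χ]` (character of `Gal(M/K)` ↦ class of the ideal `p`-th root of its radical)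
was INJECTIVE by the CM unit obstruction. When the radical character `θ̄_e = ω̄χ̄⁻¹` is EVEN (`χ̄ = ψ̄` ODD — the
Hom-side character of the crux's odd constituent, RELAXED at `p`: w2 g8/w2 g9's `R_rel(ψ)`), the kernel of
`χ ↦ [𝔟_χ]` consists of characters whose radical is a UNIT `u_χ` with `σ u_χ ≡ u_χ^{a σ m σ}` mod `K^{×p}`, distinct
characters giving units distinct mod `K^{×p}`; by HERBRAND'S UNIT THEOREM (even part; tree:
`Literature.NumberTheory.NumberFields.UnitGalois.natCard_le_of_even_eigenunits`, landed by this seat) there are at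
most `p` of them. Hence `#Gal(M/K) = #ker · #range ≤ p · #{eigenclasses}`: the odd RELAXED count
`dim R_rel(ψ) ≤ 1 + dim Hom_G(Cl_K[p], 𝔽_p(θ̄_e))` of the w7 g3 notes §2 («CASE R»), with no global duality.
* §1 **`natCard_gal_le_prime_mul_natCard_eigenclasses_of_normalised_kummer_even`** (eigenclass currency);
* §2 **`natCard_gal_le_prime_mul_classGroupChiCard_of_normalised_kummer_even`** (component currency, via p673425 §3).
THEOREMS ONLY; imports no `Theses` module. BSD is not proved by any of this; no summit statement is proved by this seat.
References: [Washington1997] §10.2 (proof of Thm. 10.9: `δ = 1` for even components — the unit contribution);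
[Lang1990] Ch. 13 §2 Thm. 2.1 (proof: «`rank B⁺ ≤ rank C_p⁺ + rank(E/E^p)⁺`»).
-/

set_option autoImplicit false
-- `…BirchSwinnertonDyer.BirchSwinnertonDyer.Theorems…` is the problem's mandated namespace (D-0017).
set_option linter.dupNamespace false

noncomputable section

namespace Summit.BirchSwinnertonDyer.BirchSwinnertonDyer.Theorems.PrintCFram.HerbrandKummer

open Literature.NumberTheory.NumberFields Literature.RepresentationTheory.FiniteGroups
open Literature.Geometry.Kaehler.FiniteAddGroup
open NumberField NumberField.IsCMField NumberField.Units IsDedekindDomain Module IntermediateField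
open scoped nonZeroDivisors Pointwise TensorProduct

set_option maxSynthPendingDepth 3

/-! ## §1 The count for an even radical character, eigenclass currency -/

section Count

variable {K : Type} [Field K] [NumberField K]

/-- **THE KUMMER REFLECTION COUNT FOR AN EVEN RADICAL CHARACTER (eigenclass currency).** Let `K` be a CM number field,
Galois over `ℚ`, `p ∤ [K:ℚ]`, `ζ ∈ K` a primitive `p`-th root of unity; `M ⊆ K̄` finite Galois over `K` with `Gal(M/K)`
ABELIAN OF EXPONENT `p`, UNRAMIFIED AT EVERY PRIME NOT ABOVE `p`; lifts `g` of every `σ ∈ Gal(K/ℚ)` with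
`τ(g x) = g(τ^{m σ} x)` (`χ̄`-normalisation), `σζ = ζ^{a σ}`; DECOMPOSITION (every `v ∣ p` is fixed by some `σ` with
`a σ m σ ≢ 1`); and a lift `θ : Gal(K/ℚ) →* ℤ_pˣ` of the RADICAL character `σ ↦ a σ · m σ (mod p)` which is EVEN
(`θ(c) = 1`) and `≠ 1`. Then **`#Gal(M/K) ≤ p · #{x ∈ Cl(𝓞 K) : x^p = 1, σ·x = (a σ m σ)•x ∀σ}`**.
PROOF: `χ ↦ [𝔟_χ]` (`α_χ` eigenvector, `β_χ = α_χ^p`, `(β_χ) = 𝔟_χ^p`) is a well-defined HOMOMORPHISM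
`Hom(Gal(M/K), Kˣ) →* Cl(𝓞 K)` into the eigenclasses (p673425's construction); a character in its kernel has a UNIT
radical `u_χ` (`𝔟_χ = (b)`, `β_χ = b^p u_χ`) with `σ u_χ = u_χ^{a σ m σ} γ^p`, and `u_χ ∈ u_{χ'} K^{×p}` forces `χ = χ'`
(§1 of p673425); Herbrand (`UnitGalois.natCard_le_of_even_eigenunits`) bounds the kernel by `p`; `#Hom = #ker · #range`.
[cite: Washington1997, §10.2 (proof of Thm. 10.9)] [cite: Lang1990, Ch. 13 §2 Thm. 2.1 (proof)] -/
theorem natCard_gal_le_prime_mul_natCard_eigenclasses_of_normalised_kummer_even [IsCMField K] [IsGalois ℚ K]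
    {p : ℕ} [Fact p.Prime] (hpK : ¬ p ∣ Module.finrank ℚ K) {ζ : K} (hζ : IsPrimitiveRoot ζ p)
    (M : IntermediateField K (AlgebraicClosure K)) [FiniteDimensional K M] [IsGalois K M]
    (hGexp : ∀ τ : M ≃ₐ[K] M, τ ^ p = 1) (hGcomm : ∀ τ τ' : M ≃ₐ[K] M, τ * τ' = τ' * τ)
    (hunr : ∀ v : HeightOneSpectrum (𝓞 K), ((p : ℕ) : 𝓞 K) ∉ v.asIdeal → Algebra.IsUnramifiedIn (𝓞 M) v.asIdeal)
    (m a : (K ≃ₐ[ℚ] K) → ℕ)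
    (hlift : ∀ σ : K ≃ₐ[ℚ] K, ∃ (g : AlgebraicClosure K ≃ₐ[ℚ] AlgebraicClosure K)
      (hgM : ∀ x : AlgebraicClosure K, x ∈ M → g x ∈ M),
      (∀ x : K, g (algebraMap K (AlgebraicClosure K) x) = algebraMap K (AlgebraicClosure K) (σ x)) ∧
      ∀ (τ : M ≃ₐ[K] M) (x : M), ((τ ⟨g x, hgM x x.2⟩ : M) : AlgebraicClosure K) = g (((τ ^ m σ) x : M) : AlgebraicClosure K))
    (ha : ∀ σ : K ≃ₐ[ℚ] K, σ ζ = ζ ^ a σ)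
    (hdec : ∀ v : HeightOneSpectrum (𝓞 K), ((p : ℕ) : 𝓞 K) ∈ v.asIdeal →
      ∃ σ : K ≃ₐ[ℚ] K, σ • v.asIdeal = v.asIdeal ∧ ¬ ((a σ * m σ : ℕ) : ZMod p) = 1)
    (θ : (K ≃ₐ[ℚ] K) →* ℤ_[p]ˣ) (hθ : ∀ σ : K ≃ₐ[ℚ] K, ‖((θ σ : ℤ_[p]ˣ) : ℤ_[p]) - ((a σ * m σ : ℕ) : ℤ_[p])‖ < 1)
    (hθ1 : θ ≠ 1) (hθc : θ ((complexConj K).restrictScalars ℚ) = 1) :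
    Nat.card (M ≃ₐ[K] M) ≤
      p * Nat.card {x : ClassGroup (𝓞 K) // x ^ p = 1 ∧
        ∀ σ : K ≃ₐ[ℚ] K, classGroupRep ℚ K σ (Additive.ofMul x) = (a σ * m σ) • Additive.ofMul x} := by
  classical
  have hp : p.Prime := Fact.out
  haveI : NumberField M := NumberField.of_module_finite K M
  -- the trivial case
  by_cases htriv : Nat.card (M ≃ₐ[K] M) = 1
  · rw [htriv]
    haveI : Nonempty {x : ClassGroup (𝓞 K) // x ^ p = 1 ∧
        ∀ σ : K ≃ₐ[ℚ] K, classGroupRep ℚ K σ (Additive.ofMul x) = (a σ * m σ) • Additive.ofMul x} :=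
      ⟨⟨1, one_pow p, fun σ => by rw [ofMul_one, map_zero, smul_zero]⟩⟩
    exact hp.one_lt.le.trans (Nat.le_mul_of_pos_right p Nat.card_pos)
  haveI : Nontrivial (M ≃ₐ[K] M) := by
    rw [← Finite.one_lt_card_iff_nontrivial]; have := Nat.card_pos (α := M ≃ₐ[K] M); omega
  letI instCG : CommGroup (M ≃ₐ[K] M) := { (inferInstance : Group (M ≃ₐ[K] M)) with mul_comm := hGcomm }
  have hexp : Monoid.exponent (M ≃ₐ[K] M) = p := by
    rw [Monoid.exponent_eq_prime_iff hp]
    intro τ hτ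
    have hd : orderOf τ ∣ p := orderOf_dvd_of_pow_eq_one (hGexp τ)
    exact ((Nat.dvd_prime hp).mp hd).resolve_left fun h => hτ (orderOf_eq_one_iff.mp h)
  haveI : HasEnoughRootsOfUnity K (Monoid.exponent (M ≃ₐ[K] M)) := by rw [hexp]; exact ⟨⟨ζ, hζ⟩, inferInstance⟩
  have hchar : Nat.card ((M ≃ₐ[K] M) →* Kˣ) = Nat.card (M ≃ₐ[K] M) :=
    CommGroup.card_monoidHom_of_hasEnoughRootsOfUnity (M ≃ₐ[K] M) K
  have hχp : ∀ (χ : (M ≃ₐ[K] M) →* Kˣ) (τ : M ≃ₐ[K] M), χ τ ^ p = 1 := fun χ τ => by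
    rw [← map_pow, hGexp, map_one]
  /- For every character `χ`: an integral eigenvector `α_χ`, `α_χ^p = β_χ ∈ 𝓞 K`, the eigen-relations
  `σ β_χ = β_χ^{a σ m σ} γ^p`, and `(β_χ) = 𝔟_χ^p`. -/
  have key : ∀ χ : (M ≃ₐ[K] M) →* Kˣ, ∃ (α : 𝓞 M) (β : 𝓞 K) (𝔟 : Ideal (𝓞 K)),
      (α : M) ≠ 0 ∧ (∀ τ : M ≃ₐ[K] M, τ (α : M) = ((χ τ : Kˣ) : K) • (α : M)) ∧
      algebraMap (𝓞 K) (𝓞 M) β = α ^ p ∧ β ≠ 0 ∧ Ideal.span {β} = 𝔟 ^ p ∧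
      ∀ σ : K ≃ₐ[ℚ] K, ∃ γ : K, σ ((β : 𝓞 K) : K) = ((β : 𝓞 K) : K) ^ (a σ * m σ) * γ ^ p := by
    intro χ
    obtain ⟨α₀, hα₀0, hα₀⟩ := KummerEigenvector.exists_eigenvector χ
    have halg : IsAlgebraic ℤ α₀ :=
      (IsFractionRing.isAlgebraic_iff ℤ ℚ M).mpr (Algebra.IsAlgebraic.isAlgebraic α₀)
    obtain ⟨y, hy0, hyint⟩ := halg.exists_integral_multiple
    have hαeig : ∀ τ : M ≃ₐ[K] M, τ (y • α₀) = ((χ τ : Kˣ) : K) • (y • α₀) := fun τ => by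
      rw [map_zsmul, hα₀ τ, smul_comm]
    have hα0 : (y • α₀ : M) ≠ 0 := smul_ne_zero hy0 hα₀0
    obtain ⟨b, hb⟩ := KummerEigenvector.pow_mem_range hαeig (hχp χ)
    have hbint : IsIntegral ℤ b := by
      apply (isIntegral_algebraMap_iff (FaithfulSMul.algebraMap_injective K M)).mp
      rw [hb]; exact hyint.pow p
    have hαβ : algebraMap (𝓞 K) (𝓞 M) ⟨b, hbint⟩ = (⟨y • α₀, hyint⟩ : 𝓞 M) ^ p := by
      apply Subtype.ext
      change algebraMap K M b = (y • α₀) ^ p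
      exact hb
    have hbne : b ≠ 0 := fun hb0 => by
      rw [hb0, map_zero] at hb; exact hα0 (pow_eq_zero_iff hp.ne_zero |>.mp hb.symm)
    set α : 𝓞 M := ⟨y • α₀, hyint⟩ with hαdef
    set β : 𝓞 K := ⟨b, hbint⟩ with hβdef
    have hβ0 : β ≠ 0 := RingOfIntegers.coe_ne_zero_iff.mp hbne
    have hαβK : ((α : M) : AlgebraicClosure K) ^ p = algebraMap K (AlgebraicClosure K) ((β : 𝓞 K) : K) := by
      have hαβM : algebraMap K M ((β : 𝓞 K) : K) = (α : M) ^ p := hb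
      rw [IsScalarTower.algebraMap_apply K M (AlgebraicClosure K), hαβM]
      rfl
    -- eigen-relations `σβ = β^{a m} γ^p`
    have heig : ∀ σ : K ≃ₐ[ℚ] K, ∃ γ : K, σ ((β : 𝓞 K) : K) = ((β : 𝓞 K) : K) ^ (a σ * m σ) * γ ^ p := by
      intro σ
      obtain ⟨g, hgM, hgK, hrel⟩ := hlift σ
      have hga : (g : AlgebraicClosure K ≃+* AlgebraicClosure K) (algebraMap K (AlgebraicClosure K) ζ) =
          algebraMap K (AlgebraicClosure K) ζ ^ a σ := by
        change g (algebraMap K (AlgebraicClosure K) ζ) = _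
        rw [hgK, ha σ, map_pow]
      obtain ⟨γ, hγ⟩ := exists_apply_radicand_eq_pow_mul_pow hp hζ (g : AlgebraicClosure K ≃+* AlgebraicClosure K)
        hgM hga hrel (RingOfIntegers.coe_ne_zero_iff.mpr hβ0) hαβK
      refine ⟨γ, FaithfulSMul.algebraMap_injective K (AlgebraicClosure K) ?_⟩
      rw [← hgK, map_mul, map_pow, map_pow]
      exact hγ
    -- `(β) = 𝔟^p`: `p ∣ ord_v(β)` at every prime `v`
    have hdvd : ∀ v : HeightOneSpectrum (𝓞 K),
        p ∣ (Associates.mk v.asIdeal).count (Associates.mk (Ideal.span {β})).factors := by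
      intro v
      by_cases hv : ((p : ℕ) : 𝓞 K) ∈ v.asIdeal
      · obtain ⟨σ, hσv, he⟩ := hdec v hv
        obtain ⟨γ, hγ⟩ := heig σ
        obtain ⟨n, d, hd, hnd⟩ := IsFractionRing.div_surjective (A := 𝓞 K) γ
        have hd0 : (d : 𝓞 K) ≠ 0 := nonZeroDivisors.ne_zero hd
        have hdK : ((d : 𝓞 K) : K) ≠ 0 := RingOfIntegers.coe_ne_zero_iff.mpr hd0
        have hrelK : σ ((β : 𝓞 K) : K) * ((d : 𝓞 K) : K) ^ p =
            ((β : 𝓞 K) : K) ^ (a σ * m σ) * ((n : 𝓞 K) : K) ^ p := by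
          rw [hγ, mul_assoc, ← mul_pow, ← hnd]
          change _ * (algebraMap (𝓞 K) K n / algebraMap (𝓞 K) K d * ((d : 𝓞 K) : K)) ^ p = _
          rw [div_mul_cancel₀ _ hdK]
        have hrel : AmbiguousClass.intAut σ β * d ^ p = β ^ (a σ * m σ) * n ^ p := by
          apply RingOfIntegers.coe_injective
          push_cast
          exact hrelK
        have hn0 : n ≠ 0 := by
          intro hn0
          rw [hn0, zero_pow hp.ne_zero, mul_zero, mul_eq_zero] at hrel
          exact hrel.elim (fun h => hβ0 ((map_eq_zero_iff _ (AmbiguousClass.intAut σ).injective).1 h))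
            fun h => hd0 ((pow_eq_zero_iff hp.ne_zero).mp h)
        have h := dvd_ord_of_eigen_of_smul_eq hp σ v hσv hβ0 hd0 hn0 hrel he
        rwa [Ideal.count_associates_factors_eq
          (by rwa [Ne, Submodule.zero_eq_bot, Ideal.span_singleton_eq_bot]) v.isPrime v.ne_bot]
      · exact dvd_count_of_eq_pow_of_isUnramifiedIn hβ0 hαβ v (hunr v hv)
    obtain ⟨𝔟, h𝔟⟩ := exists_span_eq_pow_of_forall_count_dvd hβ0 (n := p) hdvd
    exact ⟨α, β, 𝔟, hα0, hαeig, hαβ, hβ0, h𝔟, heig⟩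
  choose α β 𝔟 hα0 hαeig hαβ hβ0 h𝔟 heig using key
  have h𝔟0 : ∀ χ : (M ≃ₐ[K] M) →* Kˣ, 𝔟 χ ≠ ⊥ := fun χ h => by
    have h1 := h𝔟 χ
    rw [h, ← Ideal.zero_eq_bot, zero_pow hp.ne_zero, Ideal.zero_eq_bot, Ideal.span_singleton_eq_bot] at h1
    exact hβ0 χ h1
  have h𝔟mem : ∀ χ : (M ≃ₐ[K] M) →* Kˣ, 𝔟 χ ∈ (Ideal (𝓞 K))⁰ := fun χ => mem_nonZeroDivisors_of_ne_zero (h𝔟0 χ)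
  have hαβM : ∀ χ : (M ≃ₐ[K] M) →* Kˣ, (α χ : M) ^ p = algebraMap K M ((β χ : 𝓞 K) : K) := by
    intro χ
    have h1 := congrArg (fun z : 𝓞 M => (z : M)) (hαβ χ)
    simp only [RingOfIntegers.coe_eq_algebraMap, map_pow] at h1
    rw [← IsScalarTower.algebraMap_apply (𝓞 K) (𝓞 M) M, IsScalarTower.algebraMap_apply (𝓞 K) K M] at h1
    exact h1.symm
  -- `[𝔟_χ]` is a `p`-torsion `a·m`-eigenclass
  have hxp : ∀ χ : (M ≃ₐ[K] M) →* Kˣ, ClassGroup.mk0 ⟨𝔟 χ, h𝔟mem χ⟩ ^ p = 1 := by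
    intro χ
    have h := congrArg Additive.toMul (nsmul_mk0_eq_zero_of_span_eq_pow (hβ0 χ) (h𝔟 χ) (h𝔟mem χ))
    rwa [toMul_nsmul, toMul_ofMul, toMul_zero] at h
  have hxe : ∀ (χ : (M ≃ₐ[K] M) →* Kˣ) (σ : K ≃ₐ[ℚ] K),
      classGroupRep ℚ K σ (Additive.ofMul (ClassGroup.mk0 ⟨𝔟 χ, h𝔟mem χ⟩)) =
        (a σ * m σ) • Additive.ofMul (ClassGroup.mk0 ⟨𝔟 χ, h𝔟mem χ⟩) := by
    intro χ σ
    obtain ⟨γ, hγ⟩ := heig χ σ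
    exact classGroupRep_mk0_eq_smul_of_radicand_field hp.ne_zero σ (hβ0 χ) (h𝔟 χ) (h𝔟mem χ) hγ
  /- `[𝔟_χ]` depends only on `χ`: eigenvectors for `χ` are unique up to `K^×`. -/
  have W : ∀ (χ : (M ≃ₐ[K] M) →* Kˣ) (α' : 𝓞 M) (β' : 𝓞 K) (𝔟' : Ideal (𝓞 K))
      (h𝔟'mem : 𝔟' ∈ (Ideal (𝓞 K))⁰), (α' : M) ≠ 0 →
      (∀ τ : M ≃ₐ[K] M, τ (α' : M) = ((χ τ : Kˣ) : K) • (α' : M)) →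
      algebraMap (𝓞 K) (𝓞 M) β' = α' ^ p → Ideal.span {β'} = 𝔟' ^ p →
      ClassGroup.mk0 ⟨𝔟', h𝔟'mem⟩ = ClassGroup.mk0 ⟨𝔟 χ, h𝔟mem χ⟩ :=
    fun χ α' β' 𝔟' h𝔟'mem hα'0 hα'eig hα'β' h𝔟' =>
      KummerRank.mk0_eq_of_eigenvector K hp (h𝔟mem χ) h𝔟'mem (hαeig χ) hα'eig hα'0 (hβ0 χ) (hαβ χ) hα'β'
        (h𝔟 χ) h𝔟'
  /- `χ ↦ [𝔟_χ]` is a HOMOMORPHISM `Φ : Hom(G, Kˣ) →* Cl(𝓞 K)`. -/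
  have hmul : ∀ χ₁ χ₂ : (M ≃ₐ[K] M) →* Kˣ,
      ClassGroup.mk0 ⟨𝔟 (χ₁ * χ₂), h𝔟mem (χ₁ * χ₂)⟩ =
        ClassGroup.mk0 ⟨𝔟 χ₁, h𝔟mem χ₁⟩ * ClassGroup.mk0 ⟨𝔟 χ₂, h𝔟mem χ₂⟩ := by
    intro χ₁ χ₂
    have hmem12 : 𝔟 χ₁ * 𝔟 χ₂ ∈ (Ideal (𝓞 K))⁰ := mul_mem (h𝔟mem χ₁) (h𝔟mem χ₂)
    have hW := W (χ₁ * χ₂) (α χ₁ * α χ₂) (β χ₁ * β χ₂) (𝔟 χ₁ * 𝔟 χ₂) hmem12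
      (by push_cast; exact mul_ne_zero (hα0 χ₁) (hα0 χ₂))
      (fun τ => by
        push_cast
        rw [map_mul, hαeig χ₁ τ, hαeig χ₂ τ, MonoidHom.mul_apply, Units.val_mul, smul_mul_smul_comm])
      (by rw [map_mul, hαβ χ₁, hαβ χ₂, mul_pow])
      (by rw [← Ideal.span_singleton_mul_span_singleton, h𝔟 χ₁, h𝔟 χ₂, mul_pow])
    rw [← hW, show (⟨𝔟 χ₁ * 𝔟 χ₂, hmem12⟩ : (Ideal (𝓞 K))⁰) = ⟨𝔟 χ₁, h𝔟mem χ₁⟩ * ⟨𝔟 χ₂, h𝔟mem χ₂⟩ from rfl,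
      map_mul]
  have hone : ClassGroup.mk0 ⟨𝔟 1, h𝔟mem 1⟩ = 1 := by
    have hmem1 : (1 : Ideal (𝓞 K)) ∈ (Ideal (𝓞 K))⁰ := one_mem _
    have hW := W 1 1 1 1 hmem1 (by push_cast; exact one_ne_zero)
      (fun τ => by push_cast; rw [map_one, MonoidHom.one_apply, Units.val_one, one_smul])
      (by rw [map_one, one_pow]) (by rw [Ideal.span_singleton_one, one_pow, Ideal.one_eq_top])
    rw [← hW, show (⟨1, hmem1⟩ : (Ideal (𝓞 K))⁰) = 1 from rfl, map_one]
  let Φ : ((M ≃ₐ[K] M) →* Kˣ) →* ClassGroup (𝓞 K) :=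
    { toFun := fun χ => ClassGroup.mk0 ⟨𝔟 χ, h𝔟mem χ⟩, map_one' := hone, map_mul' := hmul }
  have hΦ : ∀ χ, Φ χ = ClassGroup.mk0 ⟨𝔟 χ, h𝔟mem χ⟩ := fun χ => rfl
  /- The range lies in the eigenclasses. -/
  have hrange : Nat.card Φ.range ≤ Nat.card {x : ClassGroup (𝓞 K) // x ^ p = 1 ∧
      ∀ σ : K ≃ₐ[ℚ] K, classGroupRep ℚ K σ (Additive.ofMul x) = (a σ * m σ) • Additive.ofMul x} := by
    have hmemr : ∀ y : Φ.range, (y.1 : ClassGroup (𝓞 K)) ^ p = 1 ∧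
        ∀ σ : K ≃ₐ[ℚ] K, classGroupRep ℚ K σ (Additive.ofMul (y.1 : ClassGroup (𝓞 K))) =
          (a σ * m σ) • Additive.ofMul (y.1 : ClassGroup (𝓞 K)) := by
      intro y
      obtain ⟨χ, hχ⟩ := y.2
      rw [← hχ, hΦ]
      exact ⟨hxp χ, hxe χ⟩
    refine Nat.card_le_card_of_injective (fun y => ⟨y.1, hmemr y⟩) fun y₁ y₂ h => ?_
    rcases y₁ with ⟨y₁, _⟩
    rcases y₂ with ⟨y₂, _⟩
    simp only [Subtype.mk.injEq] at h
    exact Subtype.ext h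
  /- The kernel: unit radicals. -/
  have hker_unit : ∀ χ : (M ≃ₐ[K] M) →* Kˣ, Φ χ = 1 →
      ∃ (b : 𝓞 K) (u : (𝓞 K)ˣ), b ≠ 0 ∧ β χ = b ^ p * u := by
    intro χ hχ
    rw [hΦ, ClassGroup.mk0_eq_one_iff] at hχ
    obtain ⟨b, hb⟩ := hχ
    have hβ : Ideal.span {β χ} = Ideal.span {b ^ p} := by
      rw [h𝔟 χ, show (𝔟 χ : Ideal (𝓞 K)) = Ideal.span {b} from hb, Ideal.span_singleton_pow]
    obtain ⟨u, hu⟩ := Ideal.span_singleton_eq_span_singleton.1 hβ.symm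
    refine ⟨b, u, fun hb0 => ?_, hu.symm⟩
    rw [hb0, zero_pow hp.ne_zero, zero_mul] at hu
    exact hβ0 χ hu.symm
  choose! b u hb0 hbu using hker_unit
  -- eigen-relation of the unit radicals
  have hueig : ∀ χ : (M ≃ₐ[K] M) →* Kˣ, Φ χ = 1 → ∀ σ : K ≃ₐ[ℚ] K, ∃ γ : K,
      σ (((u χ : 𝓞 K) : K)) = ((u χ : 𝓞 K) : K) ^ (a σ * m σ) * γ ^ p := by
    intro χ hχ σ
    obtain ⟨γ, hγ⟩ := heig χ σ
    have hbK : ((b χ : 𝓞 K) : K) ≠ 0 := RingOfIntegers.coe_ne_zero_iff.mpr (hb0 χ hχ)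
    have hσb : σ ((b χ : 𝓞 K) : K) ≠ 0 := (map_ne_zero_iff _ σ.injective).2 hbK
    have hβK : ((β χ : 𝓞 K) : K) = ((b χ : 𝓞 K) : K) ^ p * ((u χ : 𝓞 K) : K) := by
      rw [hbu χ hχ]; push_cast; rfl
    refine ⟨((b χ : 𝓞 K) : K) ^ (a σ * m σ) * γ / σ ((b χ : 𝓞 K) : K), ?_⟩
    rw [hβK, map_mul, map_pow, mul_pow, ← pow_mul] at hγ
    rw [div_pow, mul_pow, ← pow_mul, ← mul_div_assoc, eq_div_iff (pow_ne_zero _ hσb)]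
    linear_combination hγ
  -- distinct characters of the kernel give units distinct mod `K^{×p}`
  have husep : ∀ χ₁ χ₂ : (M ≃ₐ[K] M) →* Kˣ, Φ χ₁ = 1 → Φ χ₂ = 1 →
      (∃ γ : K, ((u χ₁ : 𝓞 K) : K) = ((u χ₂ : 𝓞 K) : K) * γ ^ p) → χ₁ = χ₂ := by
    rintro χ₁ χ₂ hχ₁ hχ₂ ⟨γ, hγ⟩
    -- `β₁ β₂^{p-1} = (b₁ b₂^{p-1} u₂ γ)^p`
    set y : K := ((b χ₁ : 𝓞 K) : K) * ((b χ₂ : 𝓞 K) : K) ^ (p - 1) * ((u χ₂ : 𝓞 K) : K) * γ with hy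
    obtain ⟨n, hn⟩ : ∃ n : ℕ, p = n + 1 := ⟨p - 1, (Nat.sub_add_cancel hp.one_le).symm⟩
    have hpn : p - 1 = n := by omega
    have hββ : ((β χ₁ : 𝓞 K) : K) * ((β χ₂ : 𝓞 K) : K) ^ (p - 1) = y ^ p := by
      rw [hbu χ₁ hχ₁, hbu χ₂ hχ₂, hy, hpn]
      push_cast [hγ]
      rw [hn]
      ring
    have hχ : χ₁ * χ₂ ^ (p - 1) = 1 := by
      refine eq_one_of_pow_eq_algebraMap_pow (M := M) hp hζ (α := (α χ₁ : M) * (α χ₂ : M) ^ (p - 1))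
        (mul_ne_zero (hα0 χ₁) (pow_ne_zero (p - 1) (hα0 χ₂))) (fun τ => ?_) (y := y) ?_
      · rw [map_mul, map_pow, hαeig χ₁ τ, hαeig χ₂ τ, MonoidHom.mul_apply, MonoidHom.pow_apply,
          Units.val_mul, Units.val_pow_eq_pow_val, smul_pow, smul_mul_smul_comm]
      · rw [mul_pow, ← pow_mul, mul_comm (p - 1) p, pow_mul, hαβM χ₁, hαβM χ₂,
          ← map_pow (algebraMap K M) _ (p - 1), ← map_mul, ← map_pow (algebraMap K M) y p, hββ]
    ext τ
    have h := congrArg (fun ψ : (M ≃ₐ[K] M) →* Kˣ => ((ψ τ : Kˣ) : K)) hχ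
    simp only [MonoidHom.mul_apply, MonoidHom.pow_apply, MonoidHom.one_apply, Units.val_mul,
      Units.val_pow_eq_pow_val, Units.val_one] at h
    have h2 : ((χ₂ τ : Kˣ) : K) ^ p = 1 := by
      rw [← Units.val_pow_eq_pow_val, hχp, Units.val_one]
    calc ((χ₁ τ : Kˣ) : K) = χ₁ τ * ((χ₂ τ : K) ^ (p - 1) * χ₂ τ) := by
          rw [← pow_succ, Nat.sub_add_cancel hp.one_le, h2, mul_one]
      _ = χ₂ τ := by rw [← mul_assoc, h, one_mul]
  /- Herbrand: `#ker Φ ≤ p`. -/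
  have hker : Nat.card Φ.ker ≤ p := by
    refine UnitGalois.natCard_le_of_even_eigenunits (K := K) hpK θ hθ1 hθc (fun σ => a σ * m σ)
      (fun σ => by exact_mod_cast hθ σ) (fun χ : Φ.ker => u χ.1) (fun χ σ => hueig χ.1 χ.2 σ)
      (fun χ₁ χ₂ h12 => Subtype.ext (husep χ₁.1 χ₂.1 χ₁.2 χ₂.2 h12))
  /- Count: `#G = #Hom(G, K^×) = #range · #ker ≤ #{eigenclasses} · p`. -/
  calc Nat.card (M ≃ₐ[K] M) = Nat.card ((M ≃ₐ[K] M) →* Kˣ) := hchar.symm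
    _ = Φ.ker.index * Nat.card Φ.ker := (Subgroup.index_mul_card Φ.ker).symm
    _ = Nat.card Φ.range * Nat.card Φ.ker := by rw [Subgroup.index_ker]
    _ ≤ _ := by
      rw [mul_comm p]
      exact Nat.mul_le_mul hrange hker

end Count

/-! ## §2 Component currency -/

section Bridge

variable {K : Type} [Field K] [NumberField K]

/-- **THE KUMMER REFLECTION COUNT FOR AN EVEN RADICAL CHARACTER (component currency).** With the data of
`natCard_gal_le_prime_mul_natCard_eigenclasses_of_normalised_kummer_even` (`θ` = a lift of the EVEN radical character
`σ ↦ a σ · m σ`, `θ ≠ 1`, non-trivial on the decomposition groups above `p`):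
**`#Gal(M/K) ≤ p · #e_θ(ℤ_p ⊗ Cl(𝓞 K)) = p · classGroupChiCard ℚ K p θ`** (p673425 §3 `natCard_eigenclasses_le_classGroupChiCard`).
The factor `p` is the one Minkowski unit of the even `θ`-eigenspace of `E_K/E_K^p` (Herbrand); for the odd radical
character it is absent (p673425). [cite: Washington1997, §10.2 (proof of Thm. 10.9)] [cite: Lang1990, Ch. 13 §2 Thm. 2.1 (proof)] -/
theorem natCard_gal_le_prime_mul_classGroupChiCard_of_normalised_kummer_even [IsCMField K] [IsGalois ℚ K]
    {p : ℕ} [Fact p.Prime] (hpK : ¬ p ∣ Module.finrank ℚ K) {ζ : K} (hζ : IsPrimitiveRoot ζ p)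
    (M : IntermediateField K (AlgebraicClosure K)) [FiniteDimensional K M] [IsGalois K M]
    (hGexp : ∀ τ : M ≃ₐ[K] M, τ ^ p = 1) (hGcomm : ∀ τ τ' : M ≃ₐ[K] M, τ * τ' = τ' * τ)
    (hunr : ∀ v : HeightOneSpectrum (𝓞 K), ((p : ℕ) : 𝓞 K) ∉ v.asIdeal → Algebra.IsUnramifiedIn (𝓞 M) v.asIdeal)
    (m a : (K ≃ₐ[ℚ] K) → ℕ)
    (hlift : ∀ σ : K ≃ₐ[ℚ] K, ∃ (g : AlgebraicClosure K ≃ₐ[ℚ] AlgebraicClosure K)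
      (hgM : ∀ x : AlgebraicClosure K, x ∈ M → g x ∈ M),
      (∀ x : K, g (algebraMap K (AlgebraicClosure K) x) = algebraMap K (AlgebraicClosure K) (σ x)) ∧
      ∀ (τ : M ≃ₐ[K] M) (x : M), ((τ ⟨g x, hgM x x.2⟩ : M) : AlgebraicClosure K) = g (((τ ^ m σ) x : M) : AlgebraicClosure K))
    (ha : ∀ σ : K ≃ₐ[ℚ] K, σ ζ = ζ ^ a σ)
    (hdec : ∀ v : HeightOneSpectrum (𝓞 K), ((p : ℕ) : 𝓞 K) ∈ v.asIdeal →
      ∃ σ : K ≃ₐ[ℚ] K, σ • v.asIdeal = v.asIdeal ∧ ¬ ((a σ * m σ : ℕ) : ZMod p) = 1)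
    (θ : (K ≃ₐ[ℚ] K) →* ℤ_[p]ˣ) (hθ : ∀ σ : K ≃ₐ[ℚ] K, ‖((θ σ : ℤ_[p]ˣ) : ℤ_[p]) - ((a σ * m σ : ℕ) : ℤ_[p])‖ < 1)
    (hθ1 : θ ≠ 1) (hθc : θ ((complexConj K).restrictScalars ℚ) = 1) :
    Nat.card (M ≃ₐ[K] M) ≤ p * classGroupChiCard ℚ K p (fun g => ((θ g : ℤ_[p]ˣ) : ℤ_[p])) :=
  (natCard_gal_le_prime_mul_natCard_eigenclasses_of_normalised_kummer_even hpK hζ M hGexp hGcomm hunr m a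
    hlift ha hdec θ hθ hθ1 hθc).trans
    (Nat.mul_le_mul_left p
      (natCard_eigenclasses_le_classGroupChiCard hpK θ (fun σ => a σ * m σ) (fun σ => by exact_mod_cast hθ σ)))

end Bridge

end Summit.BirchSwinnertonDyer.BirchSwinnertonDyer.Theorems.PrintCFram.HerbrandKummer

end
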